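import Mathlib.RepresentationTheory.Homological.GroupCohomology.Functoriality
import HarnessLib

/-!
# Inner automorphisms act trivially on group cohomology

For a commutative ring `k`, a group `G`, a `k`-linear representation `A` of `G` and ANY `s ∈ G`,
the pair `(c_s : h ↦ s⁻¹ h s, a ↦ ρ_A(s) a)` is a morphism of pairs `(G, A) → (G, A)` (Mathlib:
`φ : res c_s A ⟶ A`), and the induced endomorphism `groupCohomology.map c_s φ n` of `Hⁿ(G, A)` is
the IDENTITY (`map_conj_eq_id`).  For central `s` this is
`Literature.Algebra.Homology.map_eq_id_of_central` (`GroupCohomologyCentralElement`).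

Proof (the standard one, Serre *Local Fields* VII §5 Prop. 3; Brown III (8.3)), through the bar
resolution `P → k`: on inhomogeneous cochains the pair acts by `f ↦ ρ(s) ∘ f ∘ c_sⁿ`, which under
Mathlib's isomorphism `C•(G, A) ≅ Hom(P, A)` is PRECOMPOSITION with the chain endomorphism
`Θ(g₀[g₁|…|gₙ]) = g₀ s [s⁻¹g₁s|…|s⁻¹gₙs]` of `P` (`conjChainEnd`; in homogeneous coordinates, right
multiplication by `s` in every variable).  `Θ` is `G`-equivariant and lies over `𝟙 k`, so it is
homotopic to `𝟙 P` (`ProjectiveResolution.liftHomotopy`) and induces the identity on `H•(Hom(P, A))`.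

Mathlib only.

## References

* J.-P. Serre, *Local Fields*, GTM 67 (1979), Ch. VII §5, Prop. 3. [SerreLocalFields1979]
* K. S. Brown, *Cohomology of Groups*, GTM 87 (1982), III (8.3). [Brown1982CohomologyGroups]
-/

open CategoryTheory CategoryTheory.Limits groupCohomology Opposite Finsupp

namespace Literature.Algebra.Homology

universe u

variable {k G : Type u} [CommRing k] [Group G]

/-! ### The pair `(c_s, ρ(s))` -/

/-- Conjugation `h ↦ s⁻¹ h s` as a group endomorphism. [folklore] -/
def conjBy (s : G) : G →* G :=
  ((MulAut.conj s).symm : G ≃* G).toMonoidHom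

/-- Unfolding `conjBy`. [folklore] -/
@[simp]
theorem conjBy_apply (s h : G) : conjBy s h = s⁻¹ * h * s :=
  MulAut.conj_symm_apply s h

/-- The action of `s` as a morphism `res c_s A ⟶ A` of representations: `ρ(s) ρ(s⁻¹ h s) = ρ(h) ρ(s)`.
[folklore] -/
noncomputable def conjRepHom (A : Rep k G) (s : G) : Rep.res (conjBy s) A ⟶ A :=
  Rep.ofHom (LinearMap.intertwiningMap_of_isIntertwiningMap (Rep.res (conjBy s) A).ρ A.ρ (A.ρ s)
    fun g v => by
      change A.ρ s (A.ρ (conjBy s g) v) = A.ρ g (A.ρ s v)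
      rw [← Module.End.mul_apply, ← map_mul, ← Module.End.mul_apply, ← map_mul, conjBy_apply,
        ← mul_assoc, ← mul_assoc, mul_inv_cancel, one_mul])

/-- Unfolding `conjRepHom` on elements. [folklore] -/
@[simp]
theorem conjRepHom_hom_apply (A : Rep k G) (s : G) (a : A) : (conjRepHom A s).hom a = A.ρ s a := rfl

/-! ### The chain endomorphism `Θ` of the bar complex -/

/-- Conjugation of a tuple: `(x_j) ↦ (s⁻¹ x_j s)`. [folklore] -/
def conjTuple (s : G) {n : ℕ} (x : Fin n → G) : Fin n → G := fun j => s⁻¹ * x j * s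

omit [CommRing k] in
/-- `conjTuple` commutes with contracting adjacent entries. [folklore] -/
theorem contractNth_conjTuple (s : G) {n : ℕ} (j : Fin (n + 1)) (x : Fin (n + 1) → G) :
    Fin.contractNth j (· * ·) (conjTuple s x) = conjTuple s (Fin.contractNth j (· * ·) x) := by
  have h := Fin.comp_contractNth (· * ·) (· * ·) (f := fun g : G => s⁻¹ * g * s)
    (fun a b => by group) j x
  exact h.symm

/-- The degree-`n` component of `Θ`: the `G`-map `g₀[x] ↦ g₀ s [s⁻¹ x s]` of the free representation
on `Gⁿ`. [folklore] -/
noncomputable def conjChainEndF (s : G) (n : ℕ) :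
    Rep.free k G (Fin n → G) ⟶ Rep.free k G (Fin n → G) :=
  Rep.freeLift k G (Rep.free k G (Fin n → G)) fun x =>
    single (conjTuple s x) (MonoidAlgebra.single s (1 : k))

/-- `Θ(g[x] r) = (g s)[s⁻¹ x s] r`. [folklore] -/
theorem conjChainEndF_hom_single_single (s : G) {n : ℕ} (x : Fin n → G) (g : G) (r : k) :
    (conjChainEndF (k := k) s n).hom (single x (MonoidAlgebra.single g r)) =
      single (conjTuple s x) (MonoidAlgebra.single (g * s) r) := by
  rw [conjChainEndF, Rep.hom_ofHom, Representation.freeLift_single_single, Rep.of_ρ,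
    Representation.free_single_single, smul_single, MonoidAlgebra.smul_single', mul_one]

/-- The generator `1[x]` is sent to `ρ(s) (1[s⁻¹ x s])`. [folklore] -/
theorem conjChainEndF_hom_single_one (s : G) {n : ℕ} (x : Fin n → G) :
    (conjChainEndF (k := k) s n).hom (single x (MonoidAlgebra.single 1 1)) =
      (Rep.free k G (Fin n → G)).ρ s (single (conjTuple s x) (MonoidAlgebra.single 1 1)) := by
  rw [conjChainEndF_hom_single_single, Rep.of_ρ, Representation.free_single_single, one_mul, mul_one]

/-- **`Θ` is a chain endomorphism of the bar complex.** [folklore] -/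
noncomputable def conjChainEnd (s : G) : Rep.barComplex k G ⟶ Rep.barComplex k G :=
  ChainComplex.ofHom (fun n => conjChainEndF s n) fun n => by
    rw [Rep.barComplex.d_def]
    refine Rep.free_ext _ _ _ _ _ fun x => ?_
    rw [Rep.hom_comp, Rep.hom_comp, Representation.IntertwiningMap.comp_apply,
      Representation.IntertwiningMap.comp_apply]
    -- left-hand side: `d (Θ (1[x])) = ρ(s) d(1[s⁻¹xs])`
    rw [conjChainEndF_hom_single_one, Rep.hom_comm_apply, Rep.barComplex.d_single,
      Rep.barComplex.d_single, map_add, map_sum, map_add, map_sum]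
    congr 1
    · rw [conjChainEndF_hom_single_single]
      change Representation.free k G (Fin n → G) s _ = _
      rw [Representation.free_single_single]
      have h1 : s * conjTuple s x 0 = x 0 * s := by simp only [conjTuple]; group
      rw [h1]
      rfl
    · refine Finset.sum_congr rfl fun j _ => ?_
      rw [conjChainEndF_hom_single_single, one_mul, ← contractNth_conjTuple]
      change Representation.free k G (Fin n → G) s _ = _
      rw [Representation.free_single_single, mul_one]

/-- Components of `Θ`. [folklore] -/
theorem conjChainEnd_f (s : G) (n : ℕ) : (conjChainEnd (k := k) s).f n = conjChainEndF s n := rfl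

/-- `Θ` lies over `𝟙 k`: it is homotopic to the identity of the bar resolution. [folklore] -/
noncomputable def conjChainEndHomotopy (s : G) :
    Homotopy (conjChainEnd (k := k) s) (𝟙 (Rep.barComplex k G)) := by
  refine ProjectiveResolution.liftHomotopy (P := Rep.barResolution k G) (Q := Rep.barResolution k G)
    (𝟙 _) _ _ ?_ (by rw [CategoryTheory.Functor.map_id, Category.comp_id]; exact Category.id_comp _)
  rw [CategoryTheory.Functor.map_id, Category.comp_id]
  refine HomologicalComplex.to_single_hom_ext ?_
  rw [HomologicalComplex.comp_f]
  change conjChainEndF s 0 ≫ (Rep.barResolution k G).π.f 0 = (Rep.barResolution k G).π.f 0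
  rw [← cancel_mono (HomologicalComplex.singleObjXSelf (ComplexShape.down ℕ) 0
    (Rep.trivial k G k)).hom, Category.assoc]
  refine Rep.free_ext _ _ _ _ _ fun x => ?_
  rw [Rep.hom_comp, Representation.IntertwiningMap.comp_apply, conjChainEndF_hom_single_one,
    Rep.hom_comm_apply]
  have hx : conjTuple s x = x := Subsingleton.elim _ _
  rw [hx]
  rfl

/-! ### Precomposition with `Θ` on `Hom(P, A)` -/

/-- Precomposition with `Θ`, as a cochain endomorphism of `Hom(P, A)`. [folklore] -/
noncomputable def conjYonedaMap (A : Rep k G) (s : G) :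
    (Rep.barComplex k G).linearYonedaObj k A ⟶ (Rep.barComplex k G).linearYonedaObj k A :=
  (HomologicalComplex.unopFunctor (ModuleCat k) (ComplexShape.down ℕ)).map
    ((((linearYoneda k (Rep k G)).obj A).rightOp.mapHomologicalComplex (ComplexShape.down ℕ)).map
      (conjChainEnd s)).op

/-- Precomposition with `Θ` induces the IDENTITY on the cohomology of `Hom(P, A)`. [folklore] -/
theorem homologyMap_conjYonedaMap (A : Rep k G) (s : G) (n : ℕ) :
    HomologicalComplex.homologyMap (conjYonedaMap A s) n = 𝟙 _ := by
  have h := ((((linearYoneda k (Rep k G)).obj A).rightOp.mapHomotopy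
    (conjChainEndHomotopy (k := k) s)).unop).homologyMap_eq n
  rw [CategoryTheory.Functor.map_id, op_id, CategoryTheory.Functor.map_id,
    HomologicalComplex.homologyMap_id] at h
  exact h

/-- Unfolding `conjYonedaMap` on `f : P_i ⟶ A`: it is `Θ_i ≫ f`. [folklore] -/
theorem conjYonedaMap_f_apply (A : Rep k G) (s : G) (i : ℕ) (f : (Rep.barComplex k G).X i ⟶ A) :
    ((conjYonedaMap A s).f i).hom f = conjChainEndF s i ≫ f := by
  rfl

/-! ### Transport to inhomogeneous cochains -/

/-- Under Mathlib's `inhomogeneousCochains A ≅ Hom(P, A)`, the cochain map of the pair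
`(c_s, ρ(s))` is precomposition with `Θ`. [folklore] -/
theorem cochainsMap_conj_comp_inhomogeneousCochainsIso_hom (A : Rep k G) (s : G) :
    cochainsMap (conjBy s) (conjRepHom A s) ≫ (inhomogeneousCochainsIso A).hom =
      (inhomogeneousCochainsIso A).hom ≫ conjYonedaMap A s := by
  refine HomologicalComplex.hom_ext _ _ fun i => ?_
  rw [HomologicalComplex.comp_f, HomologicalComplex.comp_f]
  refine ModuleCat.hom_ext (LinearMap.ext fun x => ?_)
  have hI : (inhomogeneousCochainsIso A).hom.f i =
      (Rep.freeLiftLEquiv k G (Fin i → G) A).toModuleIso.symm.hom := by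
    simp only [groupCohomology.inhomogeneousCochainsIso, HomologicalComplex.Hom.isoOfComponents_hom_f]
  set e := Rep.freeLiftLEquiv k G (Fin i → G) A with he
  have happly : ∀ (f : Rep.free k G (Fin i → G) ⟶ A) (a : Fin i → G),
      f.hom (single a (MonoidAlgebra.single 1 1)) = e f a := fun f a => rfl
  simp only [ModuleCat.hom_comp, LinearMap.comp_apply]
  rw [hI, conjYonedaMap_f_apply]
  refine Rep.free_ext _ _ _ _ _ fun a => ?_
  rw [happly, Rep.hom_comp, Representation.IntertwiningMap.comp_apply, conjChainEndF_hom_single_one,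
    Rep.hom_comm_apply, happly]
  have hcm : (ModuleCat.Hom.hom ((cochainsMap (conjBy s) (conjRepHom A s)).f i)) x =
      fun a => A.ρ s (x (conjTuple s a)) := by
    rw [cochainsMap_f_hom]
    rfl
  rw [hcm]
  change e (e.symm _) a = A.ρ s (e (e.symm x) (conjTuple s a))
  rw [e.apply_symm_apply, e.apply_symm_apply]

/-! ### The theorem -/

/-- **Inner automorphisms act trivially on group cohomology**: for every `s ∈ G` the pair
`(h ↦ s⁻¹ h s, a ↦ ρ_A(s) a)` induces the identity of `Hⁿ(G, A)`, for every `n`.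
[cite: SerreLocalFields1979, Ch. VII §5, Prop. 3] -/
theorem map_conj_eq_id (A : Rep k G) (s : G) (n : ℕ) :
    groupCohomology.map (conjBy s) (conjRepHom A s) n = 𝟙 _ := by
  have hΨ : HomologicalComplex.homologyMap (conjYonedaMap A s) n = 𝟙 _ :=
    homologyMap_conjYonedaMap A s n
  have hc : cochainsMap (conjBy s) (conjRepHom A s) =
      (inhomogeneousCochainsIso A).hom ≫ conjYonedaMap A s ≫ (inhomogeneousCochainsIso A).inv := by
    rw [← Category.assoc, ← cochainsMap_conj_comp_inhomogeneousCochainsIso_hom, Category.assoc,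
      Iso.hom_inv_id, Category.comp_id]
  change HomologicalComplex.homologyMap (cochainsMap (conjBy s) (conjRepHom A s)) n = _
  rw [hc, HomologicalComplex.homologyMap_comp, HomologicalComplex.homologyMap_comp, hΨ,
    Category.id_comp, ← HomologicalComplex.homologyMap_comp, Iso.hom_inv_id,
    HomologicalComplex.homologyMap_id]
  rfl

/-- **Inner automorphisms act trivially** (form with an arbitrary pair): if `f h = s⁻¹ h s` and
`φ a = ρ_A(s) a`, then `Hⁿ(f, φ) = 𝟙`. [cite: SerreLocalFields1979, Ch. VII §5, Prop. 3] -/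
theorem map_eq_id_of_conj (A : Rep k G) (s : G) {f : G →* G} (hf : ∀ h, f h = s⁻¹ * h * s)
    (φ : Rep.res f A ⟶ A) (hφ : ∀ a : A, φ.hom a = A.ρ s a) (n : ℕ) :
    groupCohomology.map f φ n = 𝟙 _ := by
  have hfs : f = conjBy s := MonoidHom.ext fun h => by rw [hf, conjBy_apply]
  subst hfs
  have h : φ = conjRepHom A s :=
    Rep.hom_ext (Representation.IntertwiningMap.ext (LinearMap.ext fun a => hφ a))
  rw [h]
  exact map_conj_eq_id A s n

/-- Element form: `Hⁿ(f, φ) x = x`. [folklore] -/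
theorem map_apply_eq_self_of_conj (A : Rep k G) (s : G) {f : G →* G} (hf : ∀ h, f h = s⁻¹ * h * s)
    (φ : Rep.res f A ⟶ A) (hφ : ∀ a : A, φ.hom a = A.ρ s a) (n : ℕ) (x : groupCohomology A n) :
    (groupCohomology.map f φ n).hom x = x := by
  rw [map_eq_id_of_conj A s hf φ hφ n]
  rfl

end Literature.Algebra.Homology
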